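import Mathlib
import Summits.CriticalPhenomena.SAWScalingLimit.Theorems.SAWDefectDecoherenceObservableToSLERGateTransferHexagon

/-!
# Gate transfer, assembly 1: cells of the good event, cylinders, product cells

Support file for the stub `stub_gateTransfer` (the gate transfer
`GateDecomposition → RenewalAccumulation → CarvedToSLE → HexTight → FullIdentification`) of the
line `bridge-gate-renewal` for the crux
`Summit.CriticalPhenomena.SAWScalingLimit.Theses.SAWDefectDecoherence.ObservableToSLER`
(item `stmt-CriticalPhenomena-14005`).

* `GateLabel` (label of a cell: the two first good gates, prefix, suffix), `GateLabel.cell`,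
  `GateLabel.cyl` (the cylinder event of `GateDecomposition`), `midList`, `productCell` (the set of
  walks whose cell is a product — the interface between the topology and the measure theory of
  the gate transfer);
* bookkeeping: a cell member lies in the cylinder of its label and conversely inside a product
  cell (registered sub-goal `stub_cellEqCylinder`), labels are determined by the walk, every walk
  of the good event has a label.
-/

noncomputable section

open scoped BigOperators Topology NNReal ENNReal Classical BoundedContinuousFunction unitInterval
open Filter Set MeasureTheory Metric

namespace Summit.CriticalPhenomena.SAWScalingLimit.Theorems.ObservableToSLER.BridgeGate

open Literature.Probability.LatticeModels (HexVertex hexGraph hexCenter triZeta Site polyline)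
open Literature.Probability.RandomPlanarGeometry
open Literature.Probability.RandomPlanarGeometry.SAW

section Cells

variable {Ω : Set ℂ} {δ r R ρ : ℝ} {a b : HexVertex}

/-- The label of a cell of the good event: the first good gates `(n; m, p, q)` at the starting
vertex and `(n'; m', p', q')` at the end vertex (list reversed), the prefix `l₁` (the first `m`
vertices) and the suffix `l₂` (the last `m'` vertices). -/
structure GateLabel where
  /-- level of the first good gate at the start -/
  n : ℕ
  /-- exit index at the start -/
  m : ℕ
  /-- last prefix vertex -/
  p : HexVertex
  /-- first vertex after the prefix -/
  q : HexVertex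
  /-- level of the first good gate at the end (list reversed) -/
  n' : ℕ
  /-- exit index at the end (list reversed) -/
  m' : ℕ
  /-- first suffix vertex -/
  p' : HexVertex
  /-- last vertex before the suffix -/
  q' : HexVertex
  /-- the prefix -/
  l₁ : List HexVertex
  /-- the suffix -/
  l₂ : List HexVertex

/-- The cell labelled `κ`, as a set of vertex lists `L`: the first good gates of `L` are those
of `κ`, its prefix and suffix are those of `κ`. -/
def GateLabel.cell (κ : GateLabel) (Ω : Set ℂ) (δ r R ρ : ℝ) (a b : HexVertex) :
    Set (List HexVertex) :=
  {L | IsFirstGoodGate Ω δ r R ρ a L κ.n κ.m κ.p κ.q ∧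
    IsFirstGoodGate Ω δ r R ρ b L.reverse κ.n' κ.m' κ.p' κ.q' ∧
    L.take κ.m = κ.l₁ ∧ L.drop (L.length - κ.m') = κ.l₂}

/-- The root side at the start, for the label `κ`. -/
def GateLabel.S (κ : GateLabel) (Ω : Set ℂ) (δ : ℝ) (a : HexVertex) : Set HexVertex :=
  sideVerts Ω δ a κ.n κ.p κ.q

/-- The root side at the end, for the label `κ`. -/
def GateLabel.T (κ : GateLabel) (Ω : Set ℂ) (δ : ℝ) (b : HexVertex) : Set HexVertex :=
  sideVerts Ω δ b κ.n' κ.p' κ.q'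

/-- The cylinder of the label `κ` with respect to the vertex sets `S`, `T`: walks
`l₁ ++ mid ++ l₂` with `mid` running from `q` to `q'` and avoiding `S` and `T` (the event of
`GateDecomposition` with `B = univ`). -/
def GateLabel.cyl (κ : GateLabel) (S T : Set HexVertex) (Ω : Set ℂ) (δ : ℝ) (a b : HexVertex) :
    Set (HexDomainSAW Ω δ a b) :=
  {γ | ∃ mid : List HexVertex, mid.head? = some κ.q ∧ mid.getLast? = some κ.q' ∧
    (∀ v ∈ mid, v ∉ S ∧ v ∉ T) ∧ γ.walk.support = κ.l₁ ++ mid ++ κ.l₂}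

/-- The middle piece of a list with respect to the exit indices `m`, `m'`. -/
def midList (m m' : ℕ) (L : List HexVertex) : List HexVertex :=
  (L.drop m).take (L.length - m - m')

/-- **The product cells at mesh `δ`** (the product structure of the cells of the good event; the
topological content of the gate transfer), as the set of walks `γ₀` whose cell is a product: for
all first good gates `(n; m, p, q)`, `(n'; m', p', q')` of `γ₀` (prefix `l₁`, suffix `l₂`), the
two root sides `S`, `T` are disjoint, the prefix is a SAW from `a` to `p` inside `S`, the suffix
a SAW from `p'` to `b` inside `T`, the gates are lattice edges, the middle piece is nonempty,
EVERY walk `l₁ ++ mid ++ l₂` with `mid` from `q` to `q'` avoiding `S ∪ T` has the same first good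
gates, and the prefix (suffix) vertices are within `C` of `q` (`q'`).  The cell structure at mesh
`δ` is the statement that every walk lies in this set. -/
def productCell (Ω : Set ℂ) (δ r R ρ : ℝ) (a b : HexVertex) (C : ℝ) : Set (HexDomainSAW Ω δ a b) :=
  {γ₀ | ∀ (n m : ℕ) (p q : HexVertex) (n' m' : ℕ) (p' q' : HexVertex),
    IsFirstGoodGate Ω δ r R ρ a γ₀.walk.support n m p q →
    IsFirstGoodGate Ω δ r R ρ b γ₀.walk.support.reverse n' m' p' q' →
    Disjoint (sideVerts Ω δ a n p q) (sideVerts Ω δ b n' p' q') ∧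
    (∃ w₁ : (hexDomainGraph Ω δ).Walk a p, w₁.IsPath ∧
      w₁.support = γ₀.walk.support.take m ∧
      ∀ v ∈ γ₀.walk.support.take m, v ∈ sideVerts Ω δ a n p q) ∧
    (∃ w₂ : (hexDomainGraph Ω δ).Walk p' b, w₂.IsPath ∧
      w₂.support = γ₀.walk.support.drop (γ₀.walk.support.length - m') ∧
      ∀ v ∈ γ₀.walk.support.drop (γ₀.walk.support.length - m'), v ∈ sideVerts Ω δ b n' p' q') ∧
    (hexDomainGraph Ω δ).Adj p q ∧ (hexDomainGraph Ω δ).Adj q' p' ∧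
    m + m' < γ₀.walk.support.length ∧
    (∀ (γ : HexDomainSAW Ω δ a b) (mid : List HexVertex), mid.head? = some q →
      mid.getLast? = some q' →
      (∀ v ∈ mid, v ∉ sideVerts Ω δ a n p q ∧ v ∉ sideVerts Ω δ b n' p' q') →
      γ.walk.support = γ₀.walk.support.take m ++ mid ++
        γ₀.walk.support.drop (γ₀.walk.support.length - m') →
      IsFirstGoodGate Ω δ r R ρ a γ.walk.support n m p q ∧
      IsFirstGoodGate Ω δ r R ρ b γ.walk.support.reverse n' m' p' q') ∧
    (∀ x ∈ γ₀.walk.support.take m,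
      dist ((δ : ℂ) * hexCenter x) ((δ : ℂ) * hexCenter q) ≤ C) ∧
    (∀ x ∈ γ₀.walk.support.drop (γ₀.walk.support.length - m'),
      dist ((δ : ℂ) * hexCenter x) ((δ : ℂ) * hexCenter q') ≤ C)}

/-- List bookkeeping: a list splits as prefix, middle piece, suffix. -/
theorem take_append_midList_append_drop {m m' : ℕ} {L : List HexVertex} (h : m + m' ≤ L.length) :
    L.take m ++ midList m m' L ++ L.drop (L.length - m') = L := by
  rw [midList]
  conv_rhs => rw [← List.take_append_drop m L]
  rw [List.append_assoc]
  congr 1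
  conv_rhs => rw [← List.take_append_drop (L.length - m - m') (L.drop m)]
  congr 1
  rw [List.drop_drop]
  congr 1
  omega

/-- The middle piece of `l₁ ++ mid ++ l₂` is `mid`. -/
theorem midList_append {l₁ mid l₂ : List HexVertex} :
    midList l₁.length l₂.length (l₁ ++ mid ++ l₂) = mid := by
  have hlen : (l₁ ++ mid ++ l₂).length - l₁.length - l₂.length = mid.length := by
    simp only [List.length_append]; omega
  rw [midList, hlen, List.append_assoc, List.drop_append_of_le_length le_rfl, List.drop_length,
    List.nil_append, List.take_append_of_le_length le_rfl, List.take_length]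

/-- In a cell member the middle piece starts at `q`. -/
theorem head?_midList_of_mem_cell {κ : GateLabel} {L : List HexVertex}
    (h : L ∈ κ.cell Ω δ r R ρ a b) (hlen : κ.m + κ.m' < L.length) :
    (midList κ.m κ.m' L).head? = some κ.q := by
  rw [midList, List.head?_take, if_neg (by omega), List.head?_drop]
  exact h.1.1.2.2.1.getElem?_eq

/-- In a cell member the middle piece ends at `q'`. -/
theorem getLast?_midList_of_mem_cell {κ : GateLabel} {L : List HexVertex}
    (h : L ∈ κ.cell Ω δ r R ρ a b) (hlen : κ.m + κ.m' < L.length) :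
    (midList κ.m κ.m' L).getLast? = some κ.q' := by
  have hq' := h.2.1.1.2.2.1.getElem?_eq
  rw [← List.head?_drop, List.drop_reverse, List.head?_reverse] at hq'
  have : midList κ.m κ.m' L = (L.take (L.length - κ.m')).drop κ.m := by
    rw [midList, List.drop_take, Nat.sub_right_comm]
  rw [this, List.getLast?_drop, if_neg (by simp; omega)]
  exact hq'

/-- In a cell member the middle piece avoids both root sides (single crossing at both ends). -/
theorem midList_avoids_of_mem_cell {κ : GateLabel} {L : List HexVertex}
    (h : L ∈ κ.cell Ω δ r R ρ a b) :
    ∀ v ∈ midList κ.m κ.m' L, v ∉ κ.S Ω δ a ∧ v ∉ κ.T Ω δ b := by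
  intro v hv
  constructor
  · apply h.1.1.2.2.2.1
    rw [midList] at hv
    exact List.mem_of_mem_take hv
  · apply h.2.1.1.2.2.2.1
    rw [List.drop_reverse, List.mem_reverse]
    have : midList κ.m κ.m' L = (L.take (L.length - κ.m')).drop κ.m := by
      rw [midList, List.drop_take, Nat.sub_right_comm]
    rw [this] at hv
    exact List.mem_of_mem_drop hv

/-- A cell member lies in the cylinder of its label (given that its middle piece is nonempty). -/
theorem mem_cyl_of_mem_cell {κ : GateLabel} {γ : HexDomainSAW Ω δ a b}
    (h : γ.walk.support ∈ κ.cell Ω δ r R ρ a b) (hlen : κ.m + κ.m' < γ.walk.support.length) :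
    γ ∈ κ.cyl (κ.S Ω δ a) (κ.T Ω δ b) Ω δ a b := by
  refine ⟨midList κ.m κ.m' γ.walk.support, head?_midList_of_mem_cell h hlen,
    getLast?_midList_of_mem_cell h hlen, midList_avoids_of_mem_cell h, ?_⟩
  rw [← h.2.2.1, ← h.2.2.2, take_append_midList_append_drop hlen.le]

/-- Conversely, under the cell structure, a walk in the cylinder of the label of a cell member is
a member of the same cell. -/
theorem mem_cell_of_mem_cyl {C : ℝ} {κ : GateLabel} {γ₀ γ : HexDomainSAW Ω δ a b}
    (hcs : γ₀ ∈ productCell Ω δ r R ρ a b C) (h₀ : γ₀.walk.support ∈ κ.cell Ω δ r R ρ a b)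
    (hγ : γ ∈ κ.cyl (κ.S Ω δ a) (κ.T Ω δ b) Ω δ a b) :
    γ.walk.support ∈ κ.cell Ω δ r R ρ a b := by
  obtain ⟨mid, hh, hl, hav, hsupp⟩ := hγ
  obtain ⟨-, -, -, -, -, hlen, htr, -, -⟩ := hcs κ.n κ.m κ.p κ.q κ.n' κ.m' κ.p' κ.q' h₀.1 h₀.2.1
  rw [h₀.2.2.1, h₀.2.2.2] at htr
  obtain ⟨h1, h2⟩ := htr γ mid hh hl hav hsupp
  have hm : κ.l₁.length = κ.m := by
    rw [← h₀.2.2.1, List.length_take]; exact min_eq_left (by omega)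
  have hm' : κ.l₂.length = κ.m' := by
    rw [← h₀.2.2.2, List.length_drop]; omega
  refine ⟨h1, h2, ?_, ?_⟩
  · rw [hsupp, List.append_assoc, List.take_append_of_le_length hm.ge, ← hm, List.take_length]
  · rw [hsupp, List.length_append, List.length_append, hm']
    rw [show κ.l₁.length + mid.length + κ.m' - κ.m' = (κ.l₁ ++ mid).length by simp,
      List.drop_append_of_le_length le_rfl, List.drop_length]
    simp

/-- Cell members with the same label have … the same label data; conversely the first good gates
of a cell member determine its label. -/
theorem GateLabel.eq_of_mem_cell {κ κ' : GateLabel} {L : List HexVertex}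
    (h : L ∈ κ.cell Ω δ r R ρ a b) (h' : L ∈ κ'.cell Ω δ r R ρ a b) : κ = κ' := by
  obtain ⟨h1, h2, h3, h4⟩ := h.1.unique h'.1
  obtain ⟨h5, h6, h7, h8⟩ := h.2.1.unique h'.2.1
  have h9 : κ.l₁ = κ'.l₁ := by rw [← h.2.2.1, ← h'.2.2.1, h2]
  have h10 : κ.l₂ = κ'.l₂ := by rw [← h.2.2.2, ← h'.2.2.2, h6]
  cases κ; cases κ'
  simp only at h1 h2 h3 h4 h5 h6 h7 h8 h9 h10
  simp [h1, h2, h3, h4, h5, h6, h7, h8, h9, h10]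

/-- Every walk of the good event is a member of some cell. -/
theorem exists_mem_cell {L : List HexVertex} (ha : GoodRenewalAt Ω δ r R ρ a L)
    (hb : GoodRenewalAt Ω δ r R ρ b L.reverse) : ∃ κ : GateLabel, L ∈ κ.cell Ω δ r R ρ a b := by
  obtain ⟨n, m, p, q, h1⟩ := ha.exists_isFirstGoodGate
  obtain ⟨n', m', p', q', h2⟩ := hb.exists_isFirstGoodGate
  exact ⟨⟨n, m, p, q, n', m', p', q', L.take m, L.drop (L.length - m')⟩, h1, h2, rfl, rfl⟩

end Cells

end Summit.CriticalPhenomena.SAWScalingLimit.Theorems.ObservableToSLER.BridgeGate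

namespace Summit.CriticalPhenomena.SAWScalingLimit.Theorems.ObservableToSLER.BridgeGate

open Literature.Probability.LatticeModels (HexVertex hexGraph hexCenter triZeta Site)
open Literature.Probability.RandomPlanarGeometry
open Literature.Probability.RandomPlanarGeometry.SAW

/-- **Registered sub-goal `stub_cellEqCylinder`** (self-contained form of `mem_cell_of_mem_cyl`). -/
theorem stub_cellEqCylinder : ∀ (Ω : Set ℂ) (δ r R ρ C : ℝ) (a b : HexVertex) (κ : GateLabel) (γ₀ γ : HexDomainSAW Ω δ a b), γ₀ ∈ productCell Ω δ r R ρ a b C → γ₀.walk.support ∈ κ.cell Ω δ r R ρ a b → γ ∈ κ.cyl (κ.S Ω δ a) (κ.T Ω δ b) Ω δ a b → γ.walk.support ∈ κ.cell Ω δ r R ρ a b :=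
  fun _ _ _ _ _ _ _ _ _ _ _ hcs h₀ hγ => mem_cell_of_mem_cyl hcs h₀ hγ

end Summit.CriticalPhenomena.SAWScalingLimit.Theorems.ObservableToSLER.BridgeGate

end
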